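import Literature.MathematicalPhysics.QuantumLattice.PeriodicInteractionsCellEnergy
import Literature.MathematicalPhysics.QuantumLattice.TIStateMeanEntropy
import Literature.MathematicalPhysics.QuantumLattice.TranslationInvariantFermionStatesAreEven
import HarnessLib

/-!
# Superlattice-periodic states: evenness, and the mean entropy along aligned boxes
# (`s̄(ω) = inf_{aligned m} S(ω|_{[0,m)^d})/m^d = lim_{aligned n} S(ω|_{[0,n)^d})/n^d`)

Topic `Literature/MathematicalPhysics/QuantumLattice` (family `hubbard`; crew hubbard-fast S2/S3 «periodic models at T > 0»). Companion of
`PeriodicInteractionsCellEnergy.lean` (energy side). For a state `ω` of the lattice fermions on `ℤ^d` invariant under the rectangular superlattice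
`L_q = ⊕_i (q_i+1)ℤ e_i` (`InfVolFermionState.IsPeriodic q`, `PeriodicStatesCellAverage`):

* §1 **periodic states are even** (`IsPeriodic.isEven`, `d ≥ 1`): Araki–Moriya's argument for translation-invariant states (far-apart translates of an
  odd observable anticommute; Cauchy–Schwarz) run with SUPERLATTICE translates.
* §2 box entropies are invariant under superlattice shifts; **subadditivity over aligned tilings**: for `m` a multiple of the periods
  (`(q_i+1) ∣ m`) and every `n ≥ 1`, `S(ω|_{[0,n)^d})/n^d ≤ S(ω|_{[0,m)^d})/m^d + d·m·log 4/n` (`IsPeriodic.boxEntropyDensity_le_add`).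
* §3 hence the limsup entropy density `s̄(ω) = entropyDensitySup ω` (`TIVariationalPressure`) is CAPPED BY EVERY ALIGNED BOX
  (`IsPeriodic.entropyDensitySup_le_boxEntropyDensity`) and is the LIMIT of `S(ω|_{[0,n)^d})/n^d` along the aligned boxes
  (`IsPeriodic.tendsto_boxEntropyDensity_aligned`; along multiples `k·n` of one aligned `n`: `…_mul`). So `entropyDensitySup` is the mean entropy
  per site of a periodic state, with the same finite-box certificates as in the translation-invariant case provided the boxes are aligned.

Everything is PROVED; no definition, no named fact, no number.

## Tree / Mathlib search

REUSED: `IsPeriodic`, `periodVec` (`PeriodicStatesCellAverage`); `superlatVec`, `IsPeriodic.shift_superlatVec` (`PeriodicInteractionsCellEnergy`);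
`fermionEmbed_mul_fermionEmbed_of_odd_of_disjoint`, `normSq_expect_le`, `JordanWigner.self_eq_evenPart_add_oddPart` (`TranslationInvariantFermionStatesAreEven`);
`vonNeumannEntropy_rdm_shift` (`InfVolFermionStateRegionEntropy`); `vonNeumannEntropy_le_sum_regionEntropy_add` (`FermionBoxSubadditivity`);
`mem/disjoint/subset/card_shiftSet_smul_halfOpenBox`, `boxEntropyDensity(_apply/_le)`, `entropyDensitySup_le_of_eventually`,
`le_entropyDensitySup_of_eventually` (`TIStateMeanEntropy`, `TIVariationalPressure`); Mathlib `Filter.eventually_lt_of_limsup_lt`, `one_add_mul_le_pow`.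

## References

* H. Araki, H. Moriya, Rev. Math. Phys. 15 (2003) 93, §4.1 Def. 4.5 Remark 1 (invariant states are even), §10 (mean entropy).
  [cite: ArakiMoriya2003, §4.1 Def. 4.5 Remark 1]
* O. Bratteli, D. W. Robinson, *OAQSM 2* (1997), Prop. 6.2.38 (mean entropy for `ℤ^ν`-invariant states; periodic states via the sublattice).
  [cite: BratteliRobinsonII1997, Thm. 6.2.40]
* R. B. Israel, *Convexity in the Theory of Lattice Gases* (1979), §I.1 (periodic boundary / sublattice invariance). [cite: Israel1979, Thm. I.2.4]
-/

noncomputable section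

open scoped ComplexOrder BigOperators
open Finset Literature.InformationTheory.Entropy

namespace Literature.MathematicalPhysics.QuantumLattice

open Matrix HubbardWave0 Literature.Probability.LatticeModels ThermodynamicLimit
open _root_.Filter
open scoped _root_.Topology

namespace InfVolFermionState

variable {d : ℕ} {q : Fin d → ℕ} {ω : InfVolFermionState d}

/-! ### §1. Periodic states are even -/

/-- Far-apart SUPERLATTICE translates of a finite region are pairwise disjoint (`d ≥ 1`). [cite: ArakiMoriya2003, §4.1 Def. 4.5 Remark 1] -/
private theorem exists_superlatVec_pairwise_disjoint_shiftSet (hd : 0 < d) (q : Fin d → ℕ) (Λ : Finset (Site d)) :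
    ∃ z : Fin d → ℤ, ∀ j k : ℕ, j ≠ k →
      Disjoint (shiftSet ((j : ℤ) • superlatVec q z) Λ) (shiftSet ((k : ℤ) • superlatVec q z) Λ) := by
  set i₀ : Fin d := ⟨0, hd⟩
  set R : ℕ := Λ.sup fun x => (x i₀).natAbs with hR
  refine ⟨Pi.single i₀ ((2 * R + 1 : ℕ) : ℤ), fun j k hjk => Finset.disjoint_left.2 fun x hxj hxk => hjk ?_⟩
  rw [mem_shiftSet] at hxj hxk
  have hb : ∀ y ∈ Λ, |y i₀| ≤ R := fun y hy => by
    have := Finset.le_sup (f := fun x : Site d => (x i₀).natAbs) hy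
    rw [← Int.natCast_natAbs]
    exact_mod_cast this
  have h1 := hb _ hxj
  have h2 := hb _ hxk
  simp only [Pi.sub_apply, Pi.smul_apply, superlatVec_apply, Pi.single_eq_same, smul_eq_mul] at h1 h2
  set M : ℤ := ((2 * R + 1 : ℕ) : ℤ) * ((q i₀ : ℤ) + 1) with hM
  have hM1 : ((2 * R + 1 : ℕ) : ℤ) ≤ M := by
    rw [hM]; have : (1 : ℤ) ≤ (q i₀ : ℤ) + 1 := by linarith [Int.natCast_nonneg (q i₀)]
    nlinarith
  have hdiff : |((k : ℤ) - j) * M| ≤ 2 * R := by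
    have : ((k : ℤ) - j) * M = (x i₀ - (j : ℤ) * M) - (x i₀ - (k : ℤ) * M) := by ring
    rw [this]
    exact (abs_sub _ _).trans (by rw [hM]; linarith)
  by_contra hne
  have hkj : (1 : ℤ) ≤ |(k : ℤ) - j| := Int.one_le_abs (sub_ne_zero.2 (by exact_mod_cast (Ne.symm hne)))
  rw [abs_mul] at hdiff
  have hpos : (0 : ℤ) ≤ M := by rw [hM]; positivity
  rw [abs_of_nonneg hpos] at hdiff
  have : M ≤ |(k : ℤ) - j| * M := le_mul_of_one_le_left hpos hkj
  push_cast at this hdiff hM1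
  linarith

/-- Natural multiples of a superlattice vector are superlattice vectors. [cite: ArakiMoriya2003, §4.1] -/
theorem natCast_smul_superlatVec (q : Fin d → ℕ) (j : ℕ) (z : Fin d → ℤ) :
    (j : ℤ) • superlatVec q z = superlatVec q ((j : ℤ) • z) := by
  funext i; simp only [Pi.smul_apply, superlatVec_apply, smul_eq_mul]; ring

/-- **A periodic state vanishes on odd local observables** (`d ≥ 1`). [cite: ArakiMoriya2003, §4.1 Def. 4.5 Remark 1] -/
theorem IsPeriodic.expect_eq_zero_of_odd (hd : 0 < d) (hω : ω.IsPeriodic q) {Λ : Finset (Site d)} {O : FermionOp Λ}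
    (hO : parityAut O = -O) : ω.expect Λ O = 0 := by
  -- Step 1: the Hermitian case
  suffices hherm : ∀ X : FermionOp Λ, parityAut X = -X → X.IsHermitian → ω.expect Λ X = 0 by
    obtain ⟨X, hX⟩ : ∃ X : FermionOp Λ, X = (1 / 2 : ℂ) • (O + Oᴴ) := ⟨_, rfl⟩
    obtain ⟨Y, hY⟩ : ∃ Y : FermionOp Λ, Y = (-Complex.I / 2) • (O - Oᴴ) := ⟨_, rfl⟩
    have hOct : parityAut Oᴴ = -Oᴴ := by rw [parityAut_conjTranspose, hO, Matrix.conjTranspose_neg]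
    have hXodd : parityAut X = -X := by rw [hX, map_smul, map_add, hO, hOct, ← smul_neg, neg_add]
    have hYodd : parityAut Y = -Y := by
      rw [hY, map_smul, map_sub, hO, hOct, ← smul_neg, neg_sub_neg, neg_sub]
    have hXh : X.IsHermitian := by
      rw [Matrix.IsHermitian, hX, Matrix.conjTranspose_smul, Matrix.conjTranspose_add,
        Matrix.conjTranspose_conjTranspose, add_comm]
      congr 1
      norm_num
    have hYh : Y.IsHermitian := by
      have hstar : star (-Complex.I / 2) = Complex.I / 2 := by
        rw [star_div₀, star_neg, Complex.star_def, Complex.conj_I, neg_neg, map_ofNat]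
      rw [Matrix.IsHermitian, hY, Matrix.conjTranspose_smul, Matrix.conjTranspose_sub,
        Matrix.conjTranspose_conjTranspose, hstar, ← neg_sub O Oᴴ, smul_neg, ← neg_smul, neg_div]
    have hdec : O = X + Complex.I • Y := by
      rw [hX, hY, smul_smul, ← sub_eq_zero]
      have hI : Complex.I * (-Complex.I / 2) = (1 / 2 : ℂ) := by
        rw [mul_div_assoc', mul_neg, Complex.I_mul_I, neg_neg]
      rw [hI, ← smul_add]
      have h2 : O + Oᴴ + (O - Oᴴ) = (2 : ℂ) • O := by rw [add_add_sub_cancel, two_smul]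
      rw [h2, smul_smul]
      norm_num
    rw [hdec, map_add, hherm X hXodd hXh, map_smul, hherm Y hYodd hYh, smul_zero, add_zero]
  intro X hXodd hXh
  -- Step 2: far-apart superlattice translates
  obtain ⟨z, hz⟩ := exists_superlatVec_pairwise_disjoint_shiftSet hd q Λ
  set v : Site d := superlatVec q z with hv
  have hinv : ∀ j : ℕ, ω.shift ((j : ℤ) • v) = ω := fun j => by
    rw [hv, natCast_smul_superlatVec]; exact hω.shift_superlatVec _
  by_contra hne
  set c : ℝ := ‖ω.expect Λ X‖ ^ 2 with hc
  have hc0 : 0 < c := by rw [hc]; exact pow_pos (norm_pos_iff.2 hne) 2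
  set C : ℝ := (ω.expect Λ (Xᴴ * X)).re with hC
  obtain ⟨n, hn⟩ := exists_nat_gt (C / c)
  have hnc : C < n * c := by rwa [div_lt_iff₀ hc0] at hn
  set Λn : Finset (Site d) := (Finset.range n).biUnion fun j => shiftSet ((j : ℤ) • v) Λ with hΛn
  have hsub : ∀ j ∈ Finset.range n, shiftSet ((j : ℤ) • v) Λ ⊆ Λn := fun j hj x hx => by
    rw [hΛn, Finset.mem_biUnion]
    exact ⟨j, hj, hx⟩
  set Oj : ℕ → FermionOp Λn := fun j =>
    if hj : j ∈ Finset.range n then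
      fermionEmbed ((PolySite.shiftEmb ((j : ℤ) • v) Λ).trans (PolySite.incl (hsub j hj))) X else 0 with hOj
  have hOj_eq : ∀ j (hj : j ∈ Finset.range n), Oj j =
      fermionEmbed ((PolySite.shiftEmb ((j : ℤ) • v) Λ).trans (PolySite.incl (hsub j hj))) X := fun j hj => by
    rw [hOj]; exact dif_pos hj
  have hexp : ∀ j ∈ Finset.range n, ω.expect Λn (Oj j) = ω.expect Λ X := fun j hj => by
    rw [hOj_eq j hj, ← fermionEmbed_fermionEmbed, ω.compatible (hsub j hj), ← shift_expect, hinv]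
  have hanti : ∀ j ∈ Finset.range n, ∀ k ∈ Finset.range n, j ≠ k → Oj j * Oj k = -(Oj k * Oj j) := by
    intro j hj k hk hjk
    rw [hOj_eq j hj, hOj_eq k hk]
    refine fermionEmbed_mul_fermionEmbed_of_odd_of_disjoint _ _ ?_ hXodd hXodd
    rw [Finset.disjoint_left]
    rintro p hpj hpk
    rw [Finset.mem_map] at hpj hpk
    obtain ⟨a, -, ha⟩ := hpj
    obtain ⟨b, -, hb⟩ := hpk
    have ha' : ofLex p.1 = ofLex a.1 + (j : ℤ) • v := by rw [← ha]; rfl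
    have hb' : ofLex p.1 = ofLex b.1 + (k : ℤ) • v := by rw [← hb]; rfl
    have hmem_j : ofLex p.1 ∈ shiftSet ((j : ℤ) • v) Λ := by
      rw [ha']; exact PolySite.add_mem_shiftSet _ (PolySite.ofLex_mem a)
    have hmem_k : ofLex p.1 ∈ shiftSet ((k : ℤ) • v) Λ := by
      rw [hb']; exact PolySite.add_mem_shiftSet _ (PolySite.ofLex_mem b)
    exact Finset.disjoint_left.1 (hz j k hjk) hmem_j hmem_k
  set B : FermionOp Λn := ∑ j ∈ Finset.range n, Oj j with hB
  have hOjh : ∀ j ∈ Finset.range n, (Oj j)ᴴ = Oj j := fun j hj => by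
    rw [hOj_eq j hj, ← fermionEmbed_conjTranspose, hXh.eq]
  have hBh : Bᴴ = B := by
    rw [hB, Matrix.conjTranspose_sum]
    exact Finset.sum_congr rfl hOjh
  have hBB : Bᴴ * B = ∑ j ∈ Finset.range n, Oj j * Oj j := by
    rw [hBh, hB, Finset.sum_mul_sum, ← Finset.sum_product']
    rw [← Finset.sum_filter_add_sum_filter_not (Finset.range n ×ˢ Finset.range n) (fun p => p.1 = p.2)]
    have hdiag : ∑ p ∈ (Finset.range n ×ˢ Finset.range n).filter (fun p => p.1 = p.2), Oj p.1 * Oj p.2 =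
        ∑ j ∈ Finset.range n, Oj j * Oj j := by
      rw [Finset.sum_filter, Finset.sum_product]
      refine Finset.sum_congr rfl fun j hj => ?_
      rw [Finset.sum_ite_eq (Finset.range n) j (fun k => Oj j * Oj k)]
      simp only [hj, if_true]
    have hoff : ∑ p ∈ (Finset.range n ×ˢ Finset.range n).filter (fun p => ¬ p.1 = p.2), Oj p.1 * Oj p.2 = 0 := by
      refine Finset.sum_involution (fun p _ => (p.2, p.1)) ?_ ?_ ?_ ?_
      · intro p hp
        rw [Finset.mem_filter, Finset.mem_product] at hp
        rw [hanti p.1 hp.1.1 p.2 hp.1.2 hp.2, neg_add_cancel]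
      · intro p hp _
        rw [Finset.mem_filter] at hp
        intro h
        exact hp.2 (congrArg Prod.snd h)
      · intro p hp
        rw [Finset.mem_filter, Finset.mem_product] at hp ⊢
        exact ⟨⟨hp.1.2, hp.1.1⟩, fun h => hp.2 h.symm⟩
      · intro p _
        rfl
    rw [hdiag, hoff, add_zero]
  have hωB : ω.expect Λn B = n * ω.expect Λ X := by
    rw [hB, map_sum, Finset.sum_congr rfl hexp, Finset.sum_const, Finset.card_range, nsmul_eq_mul]
  have hωBB : (ω.expect Λn (Bᴴ * B)).re = n * C := by
    rw [hBB, map_sum, Complex.re_sum]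
    have : ∀ j ∈ Finset.range n, (ω.expect Λn (Oj j * Oj j)).re = C := fun j hj => by
      rw [hC, hOj_eq j hj, ← map_mul, ← fermionEmbed_fermionEmbed, ω.compatible (hsub j hj),
        ← shift_expect, hinv, hXh.eq]
    rw [Finset.sum_congr rfl this, Finset.sum_const, Finset.card_range, nsmul_eq_mul]
  have hCS := ω.normSq_expect_le Λn B
  rw [hωB, hωBB, norm_mul, mul_pow, Complex.norm_natCast, ← hc] at hCS
  have hC0 : 0 ≤ C := by
    rw [hC]
    exact (Complex.nonneg_iff.1 (ω.expect_nonneg Λ X)).1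
  have hn1 : (1 : ℝ) ≤ n := by
    have : (0 : ℝ) < n := lt_of_le_of_lt (div_nonneg hC0 hc0.le) hn
    exact_mod_cast Nat.one_le_iff_ne_zero.2 (by rintro rfl; simp at this)
  nlinarith [hCS, hnc, hn1, hc0]

/-- **SUPERLATTICE-PERIODIC STATES OF THE LATTICE FERMIONS (`d ≥ 1`) ARE EVEN.** [cite: ArakiMoriya2003, §4.1 Def. 4.5 Remark 1] -/
theorem IsPeriodic.isEven (hd : 0 < d) (hω : ω.IsPeriodic q) : ω.IsEven := by
  intro Λ A
  have hsplit := JordanWigner.self_eq_evenPart_add_oddPart A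
  have hodd := hω.expect_eq_zero_of_odd hd (JordanWigner.parityAut_oddPart A)
  conv_lhs => rw [hsplit]
  conv_rhs => rw [hsplit]
  rw [map_add, map_add, map_add, JordanWigner.parityAut_evenPart, JordanWigner.parityAut_oddPart,
    map_neg, hodd, neg_zero]

/-! ### §2. Box entropies and aligned tilings -/

/-- **Box entropies of a periodic state are invariant under superlattice shifts.** [cite: ArakiMoriya2003, Theorem 3.8 and §10] -/
theorem IsPeriodic.vonNeumannEntropy_rdm_shiftSet_superlatVec (hω : ω.IsPeriodic q) (z : Fin d → ℤ) (Λ : Finset (Site d)) :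
    vonNeumannEntropy (ω.rdm (shiftSet (superlatVec q z) Λ)) = vonNeumannEntropy (ω.rdm Λ) := by
  rw [← vonNeumannEntropy_rdm_shift, hω.shift_superlatVec]

/-- For `m` a multiple of the periods, `m·j` is a superlattice vector. [cite: ArakiMoriya2003, §4.1] -/
theorem smul_eq_superlatVec_of_dvd {m : ℕ} (hm : ∀ i, (q i + 1) ∣ m) (j : Site d) :
    (m : ℤ) • j = superlatVec q (fun i => ((m / (q i + 1) : ℕ) : ℤ) * j i) := by
  funext i
  obtain ⟨k, hk⟩ := hm i
  have hq : m / (q i + 1) = k := by rw [hk, Nat.mul_div_cancel_left k (Nat.succ_pos _)]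
  simp only [Pi.smul_apply, smul_eq_mul, superlatVec_apply, hq]
  rw [hk]; push_cast; ring

/-- **SUBADDITIVITY OVER AN ALIGNED BOX TILING**: for a `q`-periodic `ω` (`d ≥ 1`), `m ≥ 1` a multiple of the periods, and `km ≤ n`:
`S(ω|_{[0,n)^d}) ≤ k^d·S(ω|_{[0,m)^d}) + (n^d − k^d m^d)·log 4`. [cite: ArakiMoriya2003, Theorem 3.8 and §10] -/
theorem IsPeriodic.vonNeumannEntropy_rdm_halfOpenBox_le_tiling (hd : 0 < d) (hω : ω.IsPeriodic q) {m : ℕ} (hm : 1 ≤ m)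
    (hmq : ∀ i, (q i + 1) ∣ m) {k n : ℕ} (hkm : k * m ≤ n) :
    vonNeumannEntropy (ω.rdm (halfOpenBox d n)) ≤
      (k : ℝ) ^ d * vonNeumannEntropy (ω.rdm (halfOpenBox d m)) + ((n : ℝ) ^ d - (k : ℝ) ^ d * (m : ℝ) ^ d) * Real.log 4 := by
  have hev : parityAut (ω.rdm (halfOpenBox d n)) = ω.rdm (halfOpenBox d n) := (hω.isEven hd).parityAut_rdm _
  have h := vonNeumannEntropy_le_sum_regionEntropy_add (halfOpenBox d k)
    (fun j : Site d => shiftSet ((m : ℤ) • j) (halfOpenBox d m))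
    (fun j hj => shiftSet_smul_halfOpenBox_subset hkm hj) (fun j _ j' _ hjj' => disjoint_shiftSet_smul_halfOpenBox hm hjj')
    (ω.rdm_posSemidef _) (ω.trace_rdm _) hev
  have hsum : ∑ j ∈ halfOpenBox d k, regionEntropy (ω.rdm (halfOpenBox d n)) (shiftSet ((m : ℤ) • j) (halfOpenBox d m)) =
      (k : ℝ) ^ d * vonNeumannEntropy (ω.rdm (halfOpenBox d m)) := by
    rw [Finset.sum_congr rfl fun j hj => by
      rw [ω.regionEntropy_rdm (shiftSet_smul_halfOpenBox_subset hkm hj), smul_eq_superlatVec_of_dvd hmq,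
        hω.vonNeumannEntropy_rdm_shiftSet_superlatVec],
      Finset.sum_const, card_halfOpenBox, nsmul_eq_mul]
    push_cast
    ring
  have hcard : ((halfOpenBox d n).card : ℝ) - ∑ j ∈ halfOpenBox d k, ((shiftSet ((m : ℤ) • j) (halfOpenBox d m)).card : ℝ) =
      (n : ℝ) ^ d - (k : ℝ) ^ d * (m : ℝ) ^ d := by
    rw [Finset.sum_congr rfl fun j _ => by rw [card_shiftSet_halfOpenBox], Finset.sum_const, card_halfOpenBox, card_halfOpenBox,
      nsmul_eq_mul]
    push_cast
    ring
  rw [hsum, hcard] at h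
  exact h

/-- `1 − x^d ≤ d·(1 − x)` for `0 ≤ x` (Bernoulli). [cite: NielsenChuang2010, §11.3.4] -/
private theorem one_sub_pow_le_mul' (x : ℝ) (hx : 0 ≤ x) (d : ℕ) : 1 - x ^ d ≤ d * (1 - x) := by
  have h := one_add_mul_le_pow (a := x - 1) (by linarith) d
  have e : (1 : ℝ) + (x - 1) = x := by ring
  rw [e] at h
  linarith

/-- **EXPLICIT FINITE-BOX CAP, periodic form**: for a `q`-periodic `ω` (`d ≥ 1`), an aligned `m ≥ 1` and every `n ≥ 1`:
`S(ω|_{[0,n)^d})/n^d ≤ S(ω|_{[0,m)^d})/m^d + d·m·log 4/n`. [cite: ArakiMoriya2003, Theorem 3.8 and §10] [cite: BratteliRobinsonII1997, Thm. 6.2.40] -/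
theorem IsPeriodic.boxEntropyDensity_le_add (hd : 0 < d) (hω : ω.IsPeriodic q) {m : ℕ} (hm : 1 ≤ m) (hmq : ∀ i, (q i + 1) ∣ m)
    {n : ℕ} (hn : 1 ≤ n) : ω.boxEntropyDensity n ≤ ω.boxEntropyDensity m + d * m * Real.log 4 / n := by
  have hkm : n / m * m ≤ n := Nat.div_mul_le_self n m
  have hlt : n < n / m * m + m := Nat.lt_div_mul_add (by omega)
  have h := hω.vonNeumannEntropy_rdm_halfOpenBox_le_tiling hd hm hmq hkm
  have hn0 : (0 : ℝ) < n := by exact_mod_cast hn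
  have hm0 : (0 : ℝ) < m := by exact_mod_cast hm
  have hnd : (0 : ℝ) < (n : ℝ) ^ d := by positivity
  have hmd : (0 : ℝ) < (m : ℝ) ^ d := by positivity
  set x : ℝ := ((n / m : ℕ) : ℝ) * m / n with hx
  have hx0 : 0 ≤ x := by positivity
  have hx1 : x ≤ 1 := by
    rw [hx, div_le_one hn0]; exact_mod_cast hkm
  have h1x : 1 - x ≤ (m : ℝ) / n := by
    rw [hx, sub_le_iff_le_add, ← add_div, le_div_iff₀ hn0, one_mul]
    have : ((n : ℕ) : ℝ) ≤ (((n / m) * m + m : ℕ) : ℝ) := by exact_mod_cast hlt.le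
    push_cast at this
    linarith
  have hxd : ((n / m : ℕ) : ℝ) ^ d * (m : ℝ) ^ d = x ^ d * (n : ℝ) ^ d := by
    rw [hx, div_pow, mul_pow, div_mul_cancel₀ _ (ne_of_gt hnd)]
  set S := vonNeumannEntropy (ω.rdm (halfOpenBox d m)) with hS
  have hS0 : 0 ≤ S := vonNeumannEntropy_nonneg (ω.rdm_posSemidef _) (ω.trace_rdm _)
  have hlog4 : 0 ≤ Real.log 4 := Real.log_nonneg (by norm_num)
  rw [boxEntropyDensity_apply, boxEntropyDensity_apply, div_le_iff₀ hnd]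
  have e1 : ((n / m : ℕ) : ℝ) ^ d * S = x ^ d * ((n : ℝ) ^ d * (S / (m : ℝ) ^ d)) := by
    rw [← mul_assoc, ← hxd]; field_simp
  have hxd1 : x ^ d ≤ 1 := pow_le_one₀ hx0 hx1
  have hbern := one_sub_pow_le_mul' x hx0 d
  have hC : 0 ≤ (n : ℝ) ^ d * (S / (m : ℝ) ^ d) := mul_nonneg hnd.le (div_nonneg hS0 hmd.le)
  have h3 : x ^ d * ((n : ℝ) ^ d * (S / (m : ℝ) ^ d)) ≤ (n : ℝ) ^ d * (S / (m : ℝ) ^ d) := mul_le_of_le_one_left hC hxd1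
  have h2 : ((n : ℝ) ^ d - ((n / m : ℕ) : ℝ) ^ d * (m : ℝ) ^ d) * Real.log 4 ≤ (d * m * Real.log 4 / n) * (n : ℝ) ^ d := by
    rw [hxd]
    have e : ((n : ℝ) ^ d - x ^ d * (n : ℝ) ^ d) = (1 - x ^ d) * (n : ℝ) ^ d := by ring
    rw [e]
    have h4 : (1 - x ^ d) ≤ d * ((m : ℝ) / n) := hbern.trans (mul_le_mul_of_nonneg_left h1x (Nat.cast_nonneg d))
    have h5 : (1 - x ^ d) * (n : ℝ) ^ d * Real.log 4 ≤ d * ((m : ℝ) / n) * (n : ℝ) ^ d * Real.log 4 :=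
      mul_le_mul_of_nonneg_right (mul_le_mul_of_nonneg_right h4 hnd.le) hlog4
    have e' : d * m * Real.log 4 / n * (n : ℝ) ^ d = d * ((m : ℝ) / n) * (n : ℝ) ^ d * Real.log 4 := by ring
    rw [e']
    exact h5
  rw [e1] at h
  have e2 : (S / (m : ℝ) ^ d + d * m * Real.log 4 / n) * (n : ℝ) ^ d =
      (n : ℝ) ^ d * (S / (m : ℝ) ^ d) + d * m * Real.log 4 / n * (n : ℝ) ^ d := by
    ring
  rw [e2]
  linarith

/-! ### §3. The entropy density of a periodic state along aligned boxes -/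

/-- **EVERY ALIGNED BOX CAPS THE ENTROPY DENSITY**: `s̄(ω) ≤ S(ω|_{[0,m)^d})/m^d` for a `q`-periodic `ω` (`d ≥ 1`) and every `m ≥ 1`
with `(q_i+1) ∣ m`. [cite: ArakiMoriya2003, Theorem 3.8 and §10] [cite: BratteliRobinsonII1997, Thm. 6.2.40] -/
theorem IsPeriodic.entropyDensitySup_le_boxEntropyDensity (hd : 0 < d) (hω : ω.IsPeriodic q) {m : ℕ} (hm : 1 ≤ m)
    (hmq : ∀ i, (q i + 1) ∣ m) : ω.entropyDensitySup ≤ ω.boxEntropyDensity m := by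
  refine ω.entropyDensitySup_le_of_eventually fun ε hε => ?_
  have hlim : Tendsto (fun n : ℕ => (d : ℝ) * m * Real.log 4 / n) atTop (𝓝 0) := tendsto_const_div_atTop_nhds_zero_nat _
  filter_upwards [Filter.eventually_ge_atTop 1, (tendsto_order.1 hlim).2 ε hε] with n hn hnε
  have h := hω.boxEntropyDensity_le_add hd hm hmq hn
  rw [← boxEntropyDensity_apply]
  linarith

/-- **THE ENTROPY DENSITY IS THE LIMIT ALONG ALIGNED BOXES**: for a `q`-periodic `ω` (`d ≥ 1`) and any sequence of aligned box sides
`n_k → ∞` (`(q_i+1) ∣ n_k`), `S(ω|_{[0,n_k)^d})/n_k^d → s̄(ω)` (below by the aligned-box caps, above by the `limsup`).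
[cite: ArakiMoriya2003, Theorem 3.8 and §10] [cite: BratteliRobinsonII1997, Thm. 6.2.40] -/
theorem IsPeriodic.tendsto_boxEntropyDensity_aligned (hd : 0 < d) (hω : ω.IsPeriodic q) {ns : ℕ → ℕ}
    (hns : Tendsto ns atTop atTop) (hal : ∀ k, ∀ i, (q i + 1) ∣ ns k) :
    Tendsto (fun k => ω.boxEntropyDensity (ns k)) atTop (𝓝 ω.entropyDensitySup) := by
  rw [tendsto_order]
  constructor
  · intro a ha
    filter_upwards [hns.eventually (Filter.eventually_ge_atTop 1)] with k hk
    exact lt_of_lt_of_le ha (hω.entropyDensitySup_le_boxEntropyDensity hd hk (hal k))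
  · intro b hb
    have hbd : IsBoundedUnder (· ≤ ·) atTop ω.boxEntropyDensity := isBoundedUnder_of ⟨2 * Real.log 2, fun ℓ => ω.boxEntropyDensity_le ℓ⟩
    exact hns.eventually (Filter.eventually_lt_of_limsup_lt hb hbd)

/-- **Along the multiples of one aligned box**: `S(ω|_{[0,kn)^d})/(kn)^d → s̄(ω)` as `k → ∞` (`n ≥ 1` aligned).
[cite: ArakiMoriya2003, Theorem 3.8 and §10] -/
theorem IsPeriodic.tendsto_boxEntropyDensity_mul (hd : 0 < d) (hω : ω.IsPeriodic q) {n : ℕ} (hn : 1 ≤ n) (hnq : ∀ i, (q i + 1) ∣ n) :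
    Tendsto (fun k : ℕ => ω.boxEntropyDensity (k * n)) atTop (𝓝 ω.entropyDensitySup) :=
  hω.tendsto_boxEntropyDensity_aligned hd (tendsto_atTop_mono (fun k => Nat.le_mul_of_pos_right k hn) tendsto_id)
    fun k i => Dvd.dvd.mul_left (hnq i) k

/-- Translation-invariant states: the aligned condition is vacuous (`q = 0`), consistent with `TIStateMeanEntropy`. A translation-invariant state is
`q`-periodic for every `q`, so all results above apply to it. [cite: ArakiMoriya2003, §4.1 Def. 4.5] -/
theorem IsTranslationInvariant.tendsto_boxEntropyDensity_mul (hd : 0 < d) (hω : ω.IsTranslationInvariant) {n : ℕ} (hn : 1 ≤ n) :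
    Tendsto (fun k : ℕ => ω.boxEntropyDensity (k * n)) atTop (𝓝 ω.entropyDensitySup) :=
  (hω.isPeriodic (fun _ => 0)).tendsto_boxEntropyDensity_mul hd hn fun i => by simp

end InfVolFermionState

end Literature.MathematicalPhysics.QuantumLattice

end
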